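import Summits.CriticalPhenomena.PercolationContinuityZ3.Theses.PercExchangeRateTransport
import Summits.CriticalPhenomena.PercolationContinuityZ3.Theorems.PercExchangeRateTransportModelFactsStubPushforward
import Summits.CriticalPhenomena.PercolationContinuityZ3.Theorems.PercExchangeRateTransportModelFactsStubContDiff
import Summits.CriticalPhenomena.PercolationContinuityZ3.Theorems.PercExchangeRateTransportModelFactsStubPivotalPos
import Summits.CriticalPhenomena.PercolationContinuityZ3.Theorems.PercExchangeRateTransportModelFactsStubContAbove
import Summits.CriticalPhenomena.PercolationContinuityZ3.Theorems.PercExchangeRateTransportModelFactsStubPlanar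
import Literature.Probability.Percolation.ProdBernoulliRusso
import Literature.Probability.Percolation.SharpnessDCTProofs
import Literature.Barriers.CriticalPhenomena.KozmaNachmiasRegeneration
import Literature.Probability.LatticeModels.LupuCouplingNoInfinitelyMany
import HarnessLib

/-!
# `ModelFacts` (crux stmt-CriticalPhenomena-16064, route `PercExchangeRateTransport`) — proved

The crux `…Theses.PercExchangeRateTransport.ModelFacts` is the conjunction of ten bookkeeping
clauses for the label-coupled anisotropic bond-percolation family on `ℤ²×ℤ`: labels `U_e` i.i.d.
uniform under `μ = labelMeasure (Site 3)`; an `x`/`y`-bond is open iff `U_e ≤ p`, a `z`-bond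
(`vert e`) iff `U_e ≤ t`; `cfg p t U ⊆ E(ℤ³)` the configuration;
`Θ n p t = μ(cfg p t ∈ {0 ↔ ∂Λ_n in Λ_n})`, `θ p t = μ(cfg p t ∈ {|C(0)| = ∞})`. Clauses:
(1) `Θ_n` continuous on `ℝ²`, (2) `C¹` on the open square, (3)(4) monotone in `p`, `t`,
(5) antitone in `n`, (6) in `[0,1]`, (7) `θ = ⨅ Θ_n`, (8) `∂_pΘ_n > 0` on the open square for
`n ≥ 1`, (9) diagonal = `theta (zdGraph 3)`, (10) planar end `t = 0` = `theta (zdGraph 2)`.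

This is the composition of line `pushforward` (crux workfile
`Cruxes/ModelFacts/Lines/pushforward.lean`, lens TRANSFER: push the labels forward ONCE to the
tree's inhomogeneous product measure `prodBernoulli`, then live in its calculus), now sorry-free:
its five registered stubs are the landed Theorems files `…ModelFacts.stub_pushforward` (p165705:
`μ.map (U ↦ {e ∈ E | U e ≤ τ e}) = prodBernoulli (E.indicator (projIcc ∘ τ))`),
`….stub_contDiff` (p165963: cylinder probabilities are `C^m` in the parameters),
`….stub_pivotalPos` (p166253: `s(0, e_x)` is pivotal for `{0 ↔ ∂Λ_n}` with positive
probability, `n ≥ 1`), `….stub_contAbove` (p166100: `μ(|C(0)| = ∞) = ⨅ n μ(0 ↔ ∂Λ_n)` for laws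
carried by `E(ℤ³)`), `….stub_planar` (p165641: horizontal-only label percolation has probability
`θ_{ℤ²}(p)`).

Glue (namespace `Glue`, stated for an ARBITRARY vertical predicate `vert` where the anisotropy
split is irrelevant; no new definitions): `cfg` is thresholding at the field
`e ↦ if vert e then t else p` (`cfg_eq_threshold`); transfer of probabilities to
`prodBernoulli (E.indicator (projIcc ∘ field))` (`real_threshold_eq`, from `stub_pushforward`);
coordinatewise continuity / smoothness / `p`-derivative of the parameter field; pathwise
monotone couplings; the diagonal `cfg p p = configOfLabels p`; the null set `{U_e ≤ 0}` at the
planar end (tree `IsDiscreteGFF.labelMeasure_eval_nonpos`). The deciding theorem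
`modelFacts_proof` introduces the crux's `let`s and assembles:
(1) tree `continuous_prodBernoulli_real_of_determinedBy`; (2) `stub_contDiff`; (3)(4) coupling +
`isUpperSet_siteToBoundary`; (5) first exit `mem_siteToBoundary_of_le` (surely: `cfg ⊆ E`); (6);
(7) `stub_contAbove` on the push-forward law; (8) two-parameter Russo
`hasDerivAt_prodBernoulli_real` bounded below by its `e₀`-term and `stub_pivotalPos` (the guard
`1 ≤ n` enters at `PivotalPos.e0_mem_sym2_box`, cf. the landed tightness lemma
`Negative.modelFacts_derivPos_false_without_guard`, p145365); (9) `map_configOfLabels_holds`;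
(10) `stub_planar` off the null set. Sources: Grimmett 1999 §1.3–1.4, §2.4 (coupling,
`θ = lim`, Russo); skeleton by planner-cstrat-stmt-CriticalPhenomena-16064-b1-0.
-/

noncomputable section

open MeasureTheory Filter Topology
open Literature.Probability.Percolation Literature.Probability.LatticeModels
open Literature.Probability.Percolation.DCT16

namespace Summit.CriticalPhenomena.PercolationContinuityZ3.Theorems.ModelFacts

namespace Glue

open Classical in
/-- `cfg p t U` is thresholding at the field `e ↦ if vert e then t else p` (any predicate `vert`).
[folklore] -/
theorem cfg_eq_threshold (vert : Sym2 (Site 3) → Prop) (p t : ℝ) (U : Sym2 (Site 3) → ℝ) :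
    {e | e ∈ (zdGraph 3).edgeSet ∧ ((vert e ∧ U e ≤ t) ∨ (¬ vert e ∧ U e ≤ p))} =
      {e | e ∈ (zdGraph 3).edgeSet ∧ U e ≤ if vert e then t else p} := by
  ext e
  by_cases h : vert e <;> simp [h]

/-- Thresholding maps `U ↦ {e ∈ E | U e ≤ σ e}` are measurable (pattern
`measurable_configOfLabels`). [folklore] -/
theorem measurable_threshold (E : Set (Sym2 (Site 3))) (σ : Sym2 (Site 3) → ℝ) :
    Measurable fun U : Sym2 (Site 3) → ℝ => {e | e ∈ E ∧ U e ≤ σ e} :=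
  measurable_set_iff.2 fun e =>
    (show Measurable fun s : ℝ => (e ∈ E ∧ s ≤ σ e) from
      measurable_const.and (measurableSet_setOf.1 measurableSet_Iic)).comp (measurable_pi_apply e)

/-- **Transfer of probabilities** (from `stub_pushforward`): the label probability that the
threshold configuration at the field `σ` on `E(ℤ³)` lies in a measurable `B` is the
`prodBernoulli (E.indicator (projIcc ∘ σ))`-probability of `B`. [folklore] -/
theorem real_threshold_eq (σ : Sym2 (Site 3) → ℝ) {B : Set (Set (Sym2 (Site 3)))}
    (hB : MeasurableSet B) :
    (labelMeasure (Site 3)).real {U | {e | e ∈ (zdGraph 3).edgeSet ∧ U e ≤ σ e} ∈ B} =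
      (prodBernoulli ((zdGraph 3).edgeSet.indicator fun e =>
        Set.projIcc (0 : ℝ) 1 zero_le_one (σ e))).real B := by
  rw [← stub_pushforward (zdGraph 3).edgeSet σ, measureReal_def, measureReal_def,
    Measure.map_apply (measurable_threshold _ σ) hB]
  rfl

open Classical in
/-- Each coordinate of the parameter field is continuous on `ℝ²`. [folklore] -/
theorem continuous_param (vert : Sym2 (Site 3) → Prop) (e : Sym2 (Site 3)) :
    Continuous fun x : ℝ × ℝ => (((zdGraph 3).edgeSet.indicator fun e' =>
      Set.projIcc (0 : ℝ) 1 zero_le_one (if vert e' then x.2 else x.1)) e : ℝ) := by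
  by_cases he : e ∈ (zdGraph 3).edgeSet
  · simp only [Set.indicator_of_mem he]
    by_cases hv : vert e
    · simp only [if_pos hv]
      exact continuous_subtype_val.comp (continuous_projIcc.comp continuous_snd)
    · simp only [if_neg hv]
      exact continuous_subtype_val.comp (continuous_projIcc.comp continuous_fst)
  · simp only [Set.indicator_of_notMem he]
    exact continuous_const

open Classical in
/-- Each coordinate of the parameter field is `C¹` on the open square (there `projIcc` is the
identity). [folklore] -/
theorem contDiffOn_param (vert : Sym2 (Site 3) → Prop) (e : Sym2 (Site 3)) :
    ContDiffOn ℝ 1 (fun x : ℝ × ℝ => (((zdGraph 3).edgeSet.indicator fun e' =>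
      Set.projIcc (0 : ℝ) 1 zero_le_one (if vert e' then x.2 else x.1)) e : ℝ))
      (Set.Ioo 0 1 ×ˢ Set.Ioo 0 1) := by
  by_cases he : e ∈ (zdGraph 3).edgeSet
  · by_cases hv : vert e
    · refine contDiffOn_snd.congr fun x hx => ?_
      simp only [Set.indicator_of_mem he, if_pos hv]
      rw [Set.projIcc_of_mem _ (Set.Ioo_subset_Icc_self (Set.mem_prod.1 hx).2)]
    · refine contDiffOn_fst.congr fun x hx => ?_
      simp only [Set.indicator_of_mem he, if_neg hv]
      rw [Set.projIcc_of_mem _ (Set.Ioo_subset_Icc_self (Set.mem_prod.1 hx).1)]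
  · simp only [Set.indicator_of_notMem he]
    exact contDiffOn_const

open Classical in
/-- The `p`-derivative of each coordinate of the parameter field at an interior `p`: `1` on
horizontal bonds of `E(ℤ³)`, `0` on vertical bonds and off `E(ℤ³)`. [folklore] -/
theorem hasDerivAt_param (vert : Sym2 (Site 3) → Prop) (t : ℝ) {p : ℝ}
    (hp : p ∈ Set.Ioo (0 : ℝ) 1) (e : Sym2 (Site 3)) :
    HasDerivAt (fun b : ℝ => (((zdGraph 3).edgeSet.indicator fun e' =>
      Set.projIcc (0 : ℝ) 1 zero_le_one (if vert e' then t else b)) e : ℝ))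
      (if e ∈ (zdGraph 3).edgeSet ∧ ¬ vert e then 1 else 0) p := by
  by_cases he : e ∈ (zdGraph 3).edgeSet
  · by_cases hv : vert e
    · rw [if_neg (fun h => h.2 hv)]
      have hfun : (fun b : ℝ => (((zdGraph 3).edgeSet.indicator fun e' =>
          Set.projIcc (0 : ℝ) 1 zero_le_one (if vert e' then t else b)) e : ℝ)) =
            fun _ => (Set.projIcc (0 : ℝ) 1 zero_le_one t : ℝ) := by
        funext b
        rw [Set.indicator_of_mem he, if_pos hv]
      rw [hfun]
      exact hasDerivAt_const p _
    · rw [if_pos ⟨he, hv⟩]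
      have heq : (fun b : ℝ => b) =ᶠ[𝓝 p] fun b : ℝ => (((zdGraph 3).edgeSet.indicator
          fun e' => Set.projIcc (0 : ℝ) 1 zero_le_one (if vert e' then t else b)) e : ℝ) := by
        filter_upwards [Ioo_mem_nhds hp.1 hp.2] with b hb
        rw [Set.indicator_of_mem he, if_neg hv, Set.projIcc_of_mem _ (Set.Ioo_subset_Icc_self hb)]
      exact (hasDerivAt_id p).congr_of_eventuallyEq heq.symm
  · rw [if_neg (fun h => he h.1)]
    have hfun : (fun b : ℝ => (((zdGraph 3).edgeSet.indicator fun e' =>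
        Set.projIcc (0 : ℝ) 1 zero_le_one (if vert e' then t else b)) e : ℝ)) =
          fun _ => (0 : ℝ) := by
      funext b
      rw [Set.indicator_of_notMem he]
      rfl
    rw [hfun]
    exact hasDerivAt_const p _

open Classical in
/-- Over the open square the parameters are positive on `E(ℤ³)`. [folklore] -/
theorem param_pos (vert : Sym2 (Site 3) → Prop) {p t : ℝ} (hp : p ∈ Set.Ioo (0 : ℝ) 1)
    (ht : t ∈ Set.Ioo (0 : ℝ) 1) {e : Sym2 (Site 3)} (he : e ∈ (zdGraph 3).edgeSet) :
    0 < (((zdGraph 3).edgeSet.indicator fun e' =>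
      Set.projIcc (0 : ℝ) 1 zero_le_one (if vert e' then t else p)) e : ℝ) := by
  rw [Set.indicator_of_mem he]
  by_cases hv : vert e
  · rw [if_pos hv, Set.projIcc_of_mem _ (Set.Ioo_subset_Icc_self ht)]; exact ht.1
  · rw [if_neg hv, Set.projIcc_of_mem _ (Set.Ioo_subset_Icc_self hp)]; exact hp.1

open Classical in
/-- Over the open square the parameters are `< 1` everywhere. [folklore] -/
theorem param_lt_one (vert : Sym2 (Site 3) → Prop) {p t : ℝ} (hp : p ∈ Set.Ioo (0 : ℝ) 1)
    (ht : t ∈ Set.Ioo (0 : ℝ) 1) (e : Sym2 (Site 3)) :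
    (((zdGraph 3).edgeSet.indicator fun e' =>
      Set.projIcc (0 : ℝ) 1 zero_le_one (if vert e' then t else p)) e : ℝ) < 1 := by
  by_cases he : e ∈ (zdGraph 3).edgeSet
  · rw [Set.indicator_of_mem he]
    by_cases hv : vert e
    · rw [if_pos hv, Set.projIcc_of_mem _ (Set.Ioo_subset_Icc_self ht)]; exact ht.2
    · rw [if_neg hv, Set.projIcc_of_mem _ (Set.Ioo_subset_Icc_self hp)]; exact hp.2
  · rw [Set.indicator_of_notMem he]; exact zero_lt_one

/-- Raising `p` enlarges the configuration. [folklore] -/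
theorem cfg_mono_p (vert : Sym2 (Site 3) → Prop) {p p' : ℝ} (h : p ≤ p') (t : ℝ)
    (U : Sym2 (Site 3) → ℝ) :
    {e | e ∈ (zdGraph 3).edgeSet ∧ ((vert e ∧ U e ≤ t) ∨ (¬ vert e ∧ U e ≤ p))} ⊆
      {e | e ∈ (zdGraph 3).edgeSet ∧ ((vert e ∧ U e ≤ t) ∨ (¬ vert e ∧ U e ≤ p'))} := by
  rintro e ⟨he, ⟨hv, hU⟩ | ⟨hv, hU⟩⟩
  · exact ⟨he, Or.inl ⟨hv, hU⟩⟩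
  · exact ⟨he, Or.inr ⟨hv, hU.trans h⟩⟩

/-- Raising `t` enlarges the configuration. [folklore] -/
theorem cfg_mono_t (vert : Sym2 (Site 3) → Prop) {t t' : ℝ} (h : t ≤ t') (p : ℝ)
    (U : Sym2 (Site 3) → ℝ) :
    {e | e ∈ (zdGraph 3).edgeSet ∧ ((vert e ∧ U e ≤ t) ∨ (¬ vert e ∧ U e ≤ p))} ⊆
      {e | e ∈ (zdGraph 3).edgeSet ∧ ((vert e ∧ U e ≤ t') ∨ (¬ vert e ∧ U e ≤ p))} := by
  rintro e ⟨he, ⟨hv, hU⟩ | ⟨hv, hU⟩⟩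
  · exact ⟨he, Or.inl ⟨hv, hU.trans h⟩⟩
  · exact ⟨he, Or.inr ⟨hv, hU⟩⟩

/-- On the diagonal `t = p` the configuration is the one-level Grimmett coupling
`configOfLabels p U (zdGraph 3)`. [folklore] -/
theorem cfg_diag (vert : Sym2 (Site 3) → Prop) (p : ℝ) (U : Sym2 (Site 3) → ℝ) :
    {e | e ∈ (zdGraph 3).edgeSet ∧ ((vert e ∧ U e ≤ p) ∨ (¬ vert e ∧ U e ≤ p))} =
      configOfLabels p U (zdGraph 3) := by
  ext e
  simp only [configOfLabels, Set.mem_setOf_eq]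
  constructor
  · rintro ⟨he, ⟨-, hU⟩ | ⟨-, hU⟩⟩ <;> exact ⟨he, hU⟩
  · rintro ⟨he, hU⟩
    by_cases hv : vert e
    · exact ⟨he, Or.inl ⟨hv, hU⟩⟩
    · exact ⟨he, Or.inr ⟨hv, hU⟩⟩

/-- `{ω | ω ⊆ E(ℤ³)}` is measurable (countably many forbidden coordinates). [folklore] -/
theorem measurableSet_subset_edgeSet :
    MeasurableSet {ω : Set (Sym2 (Site 3)) | ω ⊆ (zdGraph 3).edgeSet} := by
  have h : {ω : Set (Sym2 (Site 3)) | ω ⊆ (zdGraph 3).edgeSet} =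
      {ω : Set (Sym2 (Site 3)) | ∀ i ∈ ((zdGraph 3).edgeSet)ᶜ, i ∉ ω} := by
    ext ω
    simp only [Set.mem_setOf_eq, Set.mem_compl_iff]
    exact ⟨fun hω e he heω => he (hω heω), fun h e heω => by_contra fun he => h e he heω⟩
  rw [h]
  exact measurableSet_forall_notMem_of_countable (Set.to_countable _)

/-- Off the null set `⋃ₑ {U_e ≤ 0}`, the `t = 0` configuration is the horizontal configuration.
[folklore] -/
theorem cfg_zero_eq (vert : Sym2 (Site 3) → Prop) {U : Sym2 (Site 3) → ℝ}
    (hU : ∀ e, ¬ U e ≤ 0) (p : ℝ) :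
    {e | e ∈ (zdGraph 3).edgeSet ∧ ((vert e ∧ U e ≤ 0) ∨ (¬ vert e ∧ U e ≤ p))} =
      {e | e ∈ (zdGraph 3).edgeSet ∧ ¬ vert e ∧ U e ≤ p} := by
  ext e
  simp only [Set.mem_setOf_eq]
  constructor
  · rintro ⟨he, ⟨-, h0⟩ | ⟨hv, hp⟩⟩
    · exact absurd h0 (hU e)
    · exact ⟨he, hv, hp⟩
  · rintro ⟨he, hv, hp⟩
    exact ⟨he, Or.inr ⟨hv, hp⟩⟩

/-- The first bond `e₀ = s(0, e_x)` of the straight `x`-path is a lattice edge. [folklore] -/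
theorem e₀_mem_edgeSet : s((0 : Site 3), Pi.single (0 : Fin 3) 1) ∈ (zdGraph 3).edgeSet := by
  rw [SimpleGraph.mem_edgeSet, zdGraph_adj_iff]
  exact ⟨0, Or.inl (by simp)⟩

/-- `e₀ = s(0, e_x)` is not a vertical bond `s(x, x + e_z)`. [folklore] -/
theorem not_vert_e₀ : ¬ ∃ x : Site 3, s((0 : Site 3), Pi.single (0 : Fin 3) 1) =
    s(x, x + Pi.single (2 : Fin 3) 1) := by
  rintro ⟨x, hx⟩
  rw [Sym2.eq_iff] at hx
  rcases hx with ⟨h0, h1⟩ | ⟨h0, h1⟩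
  · have := congrFun h1 0
    rw [← h0] at this
    simp at this
  · have := congrFun h0 0
    rw [← h1] at this
    simp at this

end Glue

open Glue in
open Classical in
/-- **The crux `ModelFacts` of route `PercExchangeRateTransport` (stmt-CriticalPhenomena-16064).**
Bookkeeping for the label-coupled anisotropic bond-percolation family on `ℤ²×ℤ`: each `Θ_n` is
continuous on `ℝ²`, `C¹` on the open square, nondecreasing in `p` and `t`, nonincreasing in `n`,
valued in `[0,1]`; `θ = ⨅_n Θ_n`; `∂_pΘ_n > 0` on the open square for `n ≥ 1`; the diagonal
`t = p` is bond percolation on `ℤ³` and the planar end `t = 0` is a.s. bond percolation on `ℤ²`.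
Composition of line `pushforward` over its five landed stubs (see the module docstring).
[folklore] -/
theorem modelFacts_proof :
    Summit.CriticalPhenomena.PercolationContinuityZ3.Theses.PercExchangeRateTransport.ModelFacts := by
  delta Summit.CriticalPhenomena.PercolationContinuityZ3.Theses.PercExchangeRateTransport.ModelFacts
  intro μ vert cfg Θ θ
  have hPμ : IsProbabilityMeasure μ := isProbabilityMeasure_labelMeasure (Site 3)
  -- the parameter field of the family and the transfer of probabilities to `prodBernoulli`
  set param : ℝ → ℝ → Sym2 (Site 3) → unitInterval := fun p t =>
    (zdGraph 3).edgeSet.indicator fun e => Set.projIcc (0 : ℝ) 1 zero_le_one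
      (if vert e then t else p) with hparam
  have hcfg : ∀ p t, cfg p t = fun U =>
      {e | e ∈ (zdGraph 3).edgeSet ∧ U e ≤ if vert e then t else p} :=
    fun p t => funext fun U => cfg_eq_threshold vert p t U
  have hmeas : ∀ p t, Measurable (cfg p t) := fun p t => by
    rw [hcfg]; exact measurable_threshold _ _
  have hsub : ∀ p t U, cfg p t U ⊆ (zdGraph 3).edgeSet := fun p t U e he => he.1
  have hreal : ∀ (p t : ℝ) {B : Set (Set (Sym2 (Site 3)))}, MeasurableSet B →
      μ.real {U | cfg p t U ∈ B} = (prodBernoulli (param p t)).real B := fun p t B hB => by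
    have h := real_threshold_eq (fun e => if vert e then t else p) hB
    simpa only [hcfg] using h
  have hΘ : ∀ n, (fun x : ℝ × ℝ => Θ n x.1 x.2) =
      fun x : ℝ × ℝ => (prodBernoulli (param x.1 x.2)).real (siteToBoundary 3 n) :=
    fun n => funext fun x => hreal x.1 x.2 (measurableSet_siteToBoundary 3 n)
  refine ⟨?_, ?_, ?_, ?_, ?_, ?_, ?_, ?_, ?_, ?_⟩
  · -- (1) continuity on `ℝ²`: tree `continuous_prodBernoulli_real_of_determinedBy`
    intro n
    rw [hΘ n]
    exact continuous_prodBernoulli_real_of_determinedBy (fun x : ℝ × ℝ => param x.1 x.2)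
      (determinedBy_siteToBoundary 3 n) (fun e _ => continuous_param vert e)
  · -- (2) `C¹` on the open square: `stub_contDiff`
    intro n
    rw [hΘ n]
    exact stub_contDiff (box 3 n).sym2 (siteToBoundary 3 n) (determinedBy_siteToBoundary 3 n) 1
      (fun x : ℝ × ℝ => param x.1 x.2) _ (fun e _ => contDiffOn_param vert e)
  · -- (3) monotone in `p`
    intro n t p p' h
    exact measureReal_mono fun U hU => isUpperSet_siteToBoundary 3 n (cfg_mono_p vert h t U) hU
  · -- (4) monotone in `t`
    intro n p t t' h
    exact measureReal_mono fun U hU => isUpperSet_siteToBoundary 3 n (cfg_mono_t vert h p U) hU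
  · -- (5) antitone in `n`: first exit, surely since `cfg p t U ⊆ E(ℤ³)`
    intro p t m n hmn
    exact measureReal_mono fun U hU =>
      Literature.Barriers.CriticalPhenomena.mem_siteToBoundary_of_le (hsub p t U) hmn hU
  · -- (6) values in `[0,1]`
    intro n p t
    exact ⟨measureReal_nonneg, measureReal_le_one⟩
  · -- (7) continuity from above of the push-forward law: `stub_contAbove`
    intro p t
    set ν : Measure (Set (Sym2 (Site 3))) := μ.map (cfg p t) with hν
    haveI : IsProbabilityMeasure ν := Measure.isProbabilityMeasure_map (hmeas p t).aemeasurable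
    have hae : ∀ᵐ ω ∂ν, ω ⊆ (zdGraph 3).edgeSet := by
      rw [hν, ae_map_iff (hmeas p t).aemeasurable measurableSet_subset_edgeSet]
      exact ae_of_all _ fun U => hsub p t U
    have key := stub_contAbove ν hae
    have hθ : θ p t = ν.real (percolatesAt 0) := by
      show μ.real {U | cfg p t U ∈ percolatesAt (0 : Site 3)} = _
      rw [hν, measureReal_def, measureReal_def,
        Measure.map_apply (hmeas p t) (measurableSet_percolatesAt_holds 0)]
      rfl
    have hΘν : ∀ n, Θ n p t = ν.real (siteToBoundary 3 n) := fun n => by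
      show μ.real {U | cfg p t U ∈ siteToBoundary 3 n} = _
      rw [hν, measureReal_def, measureReal_def,
        Measure.map_apply (hmeas p t) (measurableSet_siteToBoundary 3 n)]
      rfl
    rw [hθ, key]
    exact congrArg iInf (funext fun n => (hΘν n).symm)
  · -- (8) two-parameter Russo (tree) bounded below by the `e₀`-term (`stub_pivotalPos`)
    intro n hn p hp t ht
    have hfun : (fun q => Θ n q t) =
        fun q => (prodBernoulli (param q t)).real (siteToBoundary 3 n) :=
      funext fun q => hreal q t (measurableSet_siteToBoundary 3 n)
    have hR := hasDerivAt_prodBernoulli_real (fun b : ℝ => param b t)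
      (isUpperSet_siteToBoundary 3 n) (determinedBy_siteToBoundary 3 n) p
      (fun e => if e ∈ (zdGraph 3).edgeSet ∧ ¬ vert e then 1 else 0)
      (fun e _ => hasDerivAt_param vert t hp e)
    rw [hfun, hR.deriv]
    have hnn : ∀ e ∈ (box 3 n).sym2,
        0 ≤ (if e ∈ (zdGraph 3).edgeSet ∧ ¬ vert e then 1 else 0) *
          (prodBernoulli (param p t)).real {ω | IsPivotal (siteToBoundary 3 n) e ω} :=
      fun e _ => mul_nonneg (by split_ifs <;> norm_num) measureReal_nonneg
    refine lt_of_lt_of_le ?_ (Finset.single_le_sum hnn (PivotalPos.e0_mem_sym2_box hn))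
    rw [if_pos ⟨e₀_mem_edgeSet, not_vert_e₀⟩, one_mul]
    exact stub_pivotalPos (param p t) (fun e he => param_pos vert hp ht he)
      (fun e => param_lt_one vert hp ht e) n hn
  · -- (9) the diagonal is bond percolation on `ℤ³` (`map_configOfLabels_holds`)
    intro p
    have hset : {U | cfg (p : ℝ) p U ∈ percolatesAt (0 : Site 3)} =
        (fun U => configOfLabels (p : ℝ) U (zdGraph 3)) ⁻¹' percolatesAt 0 := by
      ext U
      rw [Set.mem_setOf_eq, Set.mem_preimage, ← cfg_diag vert (p : ℝ) U]
    show μ.real {U | cfg (p : ℝ) p U ∈ percolatesAt (0 : Site 3)} = _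
    rw [hset, theta, ← map_configOfLabels_holds (zdGraph 3) p, measureReal_def, measureReal_def,
      Measure.map_apply (measurable_configOfLabels _ _) (measurableSet_percolatesAt_holds 0)]
  · -- (10) the planar end, from `stub_planar` off the null set `{U_e ≤ 0}`
    intro p
    show μ.real {U | cfg (p : ℝ) 0 U ∈ percolatesAt (0 : Site 3)} = _
    rw [← stub_planar p]
    refine measureReal_congr ?_
    have hae : ∀ᵐ U ∂μ, ∀ e : Sym2 (Site 3), ¬ U e ≤ 0 := by
      rw [ae_all_iff]
      intro e
      rw [ae_iff]
      simpa using IsDiscreteGFF.labelMeasure_eval_nonpos e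
    filter_upwards [hae] with U hU
    exact congrArg (fun ω : Set (Sym2 (Site 3)) => ω ∈ percolatesAt (0 : Site 3))
      (cfg_zero_eq vert hU p)

end Summit.CriticalPhenomena.PercolationContinuityZ3.Theorems.ModelFacts

end
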